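/-
Copyright: the b2b-balaban cell (near-miss cell 7), T⁴-continuum fan-out, lineage t4-ne7b-p1 (node U5c COUNT member).
Released under the licence of the surrounding project.
-/
import Summits.QuantumFields.BalabanUV.T4Continuum.Support.ZoneDrivers

/-!
# Zone torus: the root-position binders of the zone skeleton DISCHARGED on the finite torus cell model

Summits-side support leaf of the T⁴-continuum cell (rung (B)+1 on a FINITE torus only; NOT infinite volume, NOT the
mass gap, NOT the Clay statement; NOT a proof of the spine estimate NE7b).  Lineage `t4-ne7b-p1` (generation 20),
node U5c, wall (GM) of the cell's gap census, located item G-ne7bp1g18-2: after generation 19 the (GM) side of the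
count chain displays only GEOMETRIC binders; this leaf removes three of them — the ROOT-POSITION COUNTS `hN1`∕`hN2` and
the FIBRE SHAPE `hNZ` of `ZoneSkeleton.card_admZSet_le` ∕ `ZoneDrivers.card_admZSet_root_le_crowd{,_affine}` — by
instantiating the cell type on the finite torus and PROVING them.  [folklore] finite combinatorics (counting multiples,
blocks and residues); nothing is quoted from print and nothing printed is asserted; no `[cite:]` tag.

THE MODEL (the cell's index model of the blocking maps, made periodic and finite).  At cutoff `K` the run lives on the
fine torus with `N = n·L^K` sites a side (`n` = the physical side in unit-lattice cells); cell type
`TCell d N = (Fin d → Fin N)`.  A CELL OF SCALE `s` (a site of the step-`s` lattice) is a fine point whose coordinates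
are multiples of `L^s` (`IsScale`; exactly `(n·L^{K−s})^d = n^d·Λ^{K−s}` of them for `s ≤ K`, `card_cellsAt` — the
shape `#Cell K a ≤ V·Λ^a` of the chain's cell binder, `a = K − s`, `V = n^d`, `Λ = L^d`).  The LEVEL-`t` BLOCK of a
coordinate `a` is `⌊a∕L^t⌋ ∈ [0, n·L^{K−t})`; two cells are `nearT … t r` when their scales are as declared, `t ≤ K`,
and their level-`t` blocks are within CYCLIC sup-distance `r` on `(ℤ∕nL^{K−t})^d` (`cycd`).

WHAT THIS FILE PROVES.  §1 `card_cycBall_le`: at most `2R+1` residues of `ℤ∕m` lie within cyclic distance `R` of a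
given one (rotation to the origin is injective into `[0,R] ∪ [m−R,m)`).  §2 `card_fibre_multiples_le`: the multiples
of `L^s` under ONE level-`t` block number `≤ L^{t∸s}` (`s ≤ t`: division by `L^s` injects them into an interval of
length `L^{t−s}`; `s > t`: at most one); `card_coord_le`: `≤ (2R+1)·L^{t∸s}` multiples of `L^s` have their level-`t`
block within cyclic distance `R` of a given block; `card_multiples`: exactly `M` multiples of `L^s` below `M·L^s`.
§3 `TCell`, `IsScale`, `cellsAt` (`card_cellsAt`, `card_cellsAt_real`), `nearT`, the count
`NZT d L r t s = (2⌊r⌋₊+1)^d·(L^d)^{t∸s}`, `card_core_le` (product over coordinates), and the binders PROVED: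
**`card_nearT_le`** (`hN1`: `#{y : nearT x sx y sy t r} ≤ NZT d L r t sy`), **`card_nearT_le'`** (`hN2`, by the symmetry
`nearT_comm`), **`NZT_le`** (`hNZ`: `NZT d L r t s ≤ 2^d·(r+1)^d·(L^d)^{t+1−s}` on `r ≥ 0`; `M₀ = 2^d`, `Λ = L^d`, one
spare factor `Λ`).  §4 **`card_admZSet_root_le_torus`** = `ZoneDrivers.card_admZSet_root_le_crowd_affine` ON THE TORUS
with `hN1`∕`hN2`∕`hNZ` discharged: for a well-formed genealogy, nonnegative extents under the affine contraction law and
weights `wt ≥ 1`, `#admZSet (nearT n L K) ext st G root c c₀' ≤ Λ^{partnerAges st G}·(2^d(C₀+2c₀+1)^d)^{mergeCount G}·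
mergeProd(q_Z^d) G`; linear-law form `card_admZSet_root_le_torus_linear`.  §5 decided sanity instances.

WHAT REMAINS DISPLAYED on the (GM) side after this leaf: `ext ≥ 0` with the affine contraction law, `wt ≥ 1` (the tree's
`ZoneCrowd.wtPEv`), the chronology `Chrono`, and the reading (ID) itself (G-ne7bp1g9-1: which regions, which collars,
that Bałaban's merger partners ARE `nearT` within `ext X + ext Y`); the per-record price (E2)∕(R1) (G-ne7bp1-1) is
untouched.  Located (not hidden): the model blocks by `L` per step in every direction (uniform cell model of
`T4PersistentHistoryCount.card_torusCells`); the size-ratio excess of non-uniform blockings (G-ne7bp1g18-1) stays with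
the radius `ext`, i.e. with the (ID)∕(E2) owners.

HONEST DEPENDENCY (cell): continuum YM on T⁴ ⇐ BetaPertH ∧ nine spine estimates (0/9 proved); BetaPertH ⇐ (D1) ∧ (D4)
∧ CAP+tail.  This file changes none of it.
-/

open Finset
open Literature.MathematicalPhysics.QuantumFieldTheory.Balaban1983to89
open T4PersistenceDictionary T4PartnerMultiplicity
open Summit.QuantumFields.BalabanUV.T4Continuum.ZoneSkeleton

namespace Summit.QuantumFields.BalabanUV.T4Continuum.ZoneTorus

/-! ## §1 Cyclic distance and the ball count on a cycle -/

/-- CYCLIC DISTANCE on `ℤ∕m` between residues represented by naturals `a b < m`. [folklore] -/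
def cycd (m a b : ℕ) : ℕ := min (Nat.dist a b) (m - Nat.dist a b)

/-- `cycd` is symmetric [folklore] -/
theorem cycd_comm (m a b : ℕ) : cycd m a b = cycd m b a := by
  simp [cycd, Nat.dist_comm]

/-- rotation of `[0,m)` taking `b₀` to `0` [folklore] -/
def rot (m b₀ b : ℕ) : ℕ := if b₀ ≤ b then b - b₀ else b + m - b₀

/-- the rotation stays in `[0,m)` [folklore] -/
theorem rot_lt {m b₀ b : ℕ} (hb₀ : b₀ < m) (hb : b < m) : rot m b₀ b < m := by
  unfold rot; split_ifs <;> omega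

/-- the rotation is injective on `[0,m)` [folklore] -/
theorem rot_injOn {m b₀ : ℕ} (hb₀ : b₀ < m) : Set.InjOn (rot m b₀) (Set.Iio m) := by
  intro b hb b' hb' h
  simp only [Set.mem_Iio] at hb hb'
  unfold rot at h
  split_ifs at h <;> omega

/-- cyclic distance to `b₀` = distance of the rotated point to `0` on the cycle [folklore] -/
theorem cycd_eq_min_rot {m b₀ : ℕ} (hb₀ : b₀ < m) (b : ℕ) :
    cycd m b₀ b = min (rot m b₀ b) (m - rot m b₀ b) := by
  unfold cycd rot Nat.dist
  split_ifs with h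
  · rw [Nat.sub_eq_zero_of_le h, zero_add]
  · push Not at h
    rw [Nat.sub_eq_zero_of_le h.le, add_zero]
    have h2 : b + m - b₀ = m - (b₀ - b) := by omega
    have h3 : m - (m - (b₀ - b)) = b₀ - b := by omega
    rw [h2, h3, min_comm]

/-- **AT MOST `2R+1` RESIDUES of `ℤ∕m` lie within cyclic distance `R` of a given residue.** [folklore] -/
theorem card_cycBall_le {m b₀ : ℕ} (hb₀ : b₀ < m) (R : ℕ) :
    ((range m).filter fun b => cycd m b₀ b ≤ R).card ≤ 2 * R + 1 := by
  have hmaps : Set.MapsTo (rot m b₀) ((range m).filter (fun b => cycd m b₀ b ≤ R) : Finset ℕ)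
      (range (R + 1) ∪ Ico (m - R) m : Finset ℕ) := by
    intro b hb
    have hb' := mem_filter.1 (mem_coe.1 hb)
    rw [mem_range] at hb'
    have hr := rot_lt hb₀ hb'.1
    have hc := hb'.2
    rw [cycd_eq_min_rot hb₀] at hc
    rw [mem_coe, mem_union, mem_range, mem_Ico]
    rcases min_le_iff.1 hc with h | h
    · left; omega
    · right; omega
  have hinj : Set.InjOn (rot m b₀) ((range m).filter (fun b => cycd m b₀ b ≤ R) : Finset ℕ) :=
    (rot_injOn hb₀).mono fun b hb => by
      have hb' := mem_filter.1 (mem_coe.1 hb)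
      exact Set.mem_Iio.2 (mem_range.1 hb'.1)
  calc ((range m).filter fun b => cycd m b₀ b ≤ R).card ≤ (range (R + 1) ∪ Ico (m - R) m).card :=
        card_le_card_of_injOn (rot m b₀) hmaps hinj
    _ ≤ (range (R + 1)).card + (Ico (m - R) m).card := card_union_le _ _
    _ ≤ 2 * R + 1 := by rw [card_range, Nat.card_Ico]; omega

/-! ## §2 Multiples of `L^s` under one level-`t` block, and the coordinate count -/

/-- **THE BLOCKING FIBRE ON THE SCALE-`s` CELLS**: among the multiples of `L^s` in `Fin N`, those with level-`t` block
`⌊a∕L^t⌋ = b` number at most `L^{t∸s}` (`L ≥ 1`; truncated subtraction: for `s > t` at most one). [folklore] -/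
theorem card_fibre_multiples_le {L : ℕ} (hL : 1 ≤ L) (N s t b : ℕ) :
    ((univ : Finset (Fin N)).filter fun a : Fin N => L ^ s ∣ a.val ∧ a.val / L ^ t = b).card ≤ L ^ (t - s) := by
  have hps : 0 < L ^ s := pow_pos hL s
  have hpt : 0 < L ^ t := pow_pos hL t
  by_cases hst : s ≤ t
  · -- division by `L^s` injects the fibre into an interval of length `L^{t-s}`
    have hq : L ^ t = L ^ s * L ^ (t - s) := by rw [← pow_add, Nat.add_sub_cancel' hst]
    have hmaps : Set.MapsTo (fun a : Fin N => a.val / L ^ s)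
        ((univ : Finset (Fin N)).filter fun a : Fin N => L ^ s ∣ a.val ∧ a.val / L ^ t = b)
        (Ico (b * L ^ (t - s)) (b * L ^ (t - s) + L ^ (t - s)) : Finset ℕ) := by
      intro a ha
      obtain ⟨⟨u, hu⟩, hab⟩ := (mem_filter.1 (mem_coe.1 ha)).2
      have hu' : a.val / L ^ s = u := by rw [hu, Nat.mul_div_cancel_left _ hps]
      simp only [mem_coe, mem_Ico]
      rw [hu']
      have h1 : b * L ^ t ≤ a.val := by rw [← hab]; exact Nat.div_mul_le_self _ _
      have h2 : a.val < b * L ^ t + L ^ t := by rw [← hab]; exact Nat.lt_div_mul_add hpt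
      rw [hq, hu] at h1 h2
      refine ⟨Nat.le_of_mul_le_mul_left (?_ : L ^ s * (b * L ^ (t - s)) ≤ L ^ s * u) hps,
        Nat.lt_of_mul_lt_mul_left (a := L ^ s) ?_⟩
      · calc L ^ s * (b * L ^ (t - s)) = b * (L ^ s * L ^ (t - s)) := by ring
          _ ≤ L ^ s * u := h1
      · calc L ^ s * u < b * (L ^ s * L ^ (t - s)) + L ^ s * L ^ (t - s) := h2
          _ = L ^ s * (b * L ^ (t - s) + L ^ (t - s)) := by ring
    have hinj : Set.InjOn (fun a : Fin N => a.val / L ^ s)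
        ((univ : Finset (Fin N)).filter fun a : Fin N => L ^ s ∣ a.val ∧ a.val / L ^ t = b) := by
      intro a ha a' ha' h
      have hda := (mem_filter.1 (mem_coe.1 ha)).2.1
      have hda' := (mem_filter.1 (mem_coe.1 ha')).2.1
      apply Fin.ext
      have e1 : a.val = L ^ s * (a.val / L ^ s) := (Nat.mul_div_cancel' hda).symm
      have e2 : a'.val = L ^ s * (a'.val / L ^ s) := (Nat.mul_div_cancel' hda').symm
      rw [e1, e2]
      exact congrArg (L ^ s * ·) h
    calc ((univ : Finset (Fin N)).filter fun a : Fin N => L ^ s ∣ a.val ∧ a.val / L ^ t = b).card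
        ≤ (Ico (b * L ^ (t - s)) (b * L ^ (t - s) + L ^ (t - s))).card := card_le_card_of_injOn _ hmaps hinj
      _ = L ^ (t - s) := by rw [Nat.card_Ico]; omega
  · -- `s > t`: two multiples of `L^s` under the same level-`t` block coincide
    push Not at hst
    have hts : t - s = 0 := Nat.sub_eq_zero_of_le hst.le
    rw [hts, pow_zero]
    refine Finset.card_le_one.2 fun a ha a' ha' => ?_
    have hq : L ^ s = L ^ t * L ^ (s - t) := by rw [← pow_add, Nat.add_sub_cancel' hst.le]
    have hpst : 0 < L ^ (s - t) := pow_pos hL _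
    obtain ⟨⟨u, hu⟩, hab⟩ := (mem_filter.1 ha).2
    obtain ⟨⟨u', hu'⟩, hab'⟩ := (mem_filter.1 ha').2
    have hb1 : a.val / L ^ t = L ^ (s - t) * u := by rw [hu, hq, mul_assoc, Nat.mul_div_cancel_left _ hpt]
    have hb2 : a'.val / L ^ t = L ^ (s - t) * u' := by rw [hu', hq, mul_assoc, Nat.mul_div_cancel_left _ hpt]
    have huu : u = u' := Nat.eq_of_mul_eq_mul_left hpst (by rw [← hb1, ← hb2, hab, hab'])
    apply Fin.ext
    rw [hu, hu', huu]

/-- **THE COORDINATE COUNT**: the multiples `a` of `L^s` in `Fin N`, `N = m·L^t`, whose level-`t` block `⌊a∕L^t⌋` lies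
within cyclic distance `R` of a block `b₀ < m` number at most `(2R+1)·L^{t∸s}`. [folklore] -/
theorem card_coord_le {L : ℕ} (hL : 1 ≤ L) {N m t b₀ : ℕ} (hN : N = m * L ^ t) (hb₀ : b₀ < m) (s R : ℕ) :
    ((univ : Finset (Fin N)).filter fun a : Fin N => L ^ s ∣ a.val ∧ cycd m b₀ (a.val / L ^ t) ≤ R).card
      ≤ (2 * R + 1) * L ^ (t - s) := by
  have hpt : 0 < L ^ t := pow_pos hL t
  set S := (univ : Finset (Fin N)).filter fun a => L ^ s ∣ a.val ∧ cycd m b₀ (a.val / L ^ t) ≤ R with hS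
  set B := (range m).filter fun b => cycd m b₀ b ≤ R with hB
  have hmaps : ∀ a ∈ S, a.val / L ^ t ∈ B := by
    intro a ha
    have ha' := (mem_filter.1 ha).2
    rw [hB, mem_filter, mem_range]
    refine ⟨(Nat.div_lt_iff_lt_mul hpt).2 ?_, ha'.2⟩
    rw [← hN]; exact a.isLt
  have hfib : ∀ b ∈ B, (S.filter fun a => a.val / L ^ t = b).card ≤ L ^ (t - s) := by
    intro b _
    refine le_trans (card_le_card ?_) (card_fibre_multiples_le hL N s t b)
    intro a ha
    rw [mem_filter] at ha ⊢
    exact ⟨mem_univ _, (mem_filter.1 ha.1).2.1, ha.2⟩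
  calc S.card ≤ L ^ (t - s) * B.card := card_le_mul_card_image_of_maps_to hmaps _ hfib
    _ ≤ L ^ (t - s) * (2 * R + 1) := Nat.mul_le_mul_left _ (card_cycBall_le hb₀ R)
    _ = (2 * R + 1) * L ^ (t - s) := mul_comm _ _

/-- **EXACTLY `M` MULTIPLES of `L^s` below `M·L^s`** (`L ≥ 1`). [folklore] -/
theorem card_multiples {L : ℕ} (hL : 1 ≤ L) {N M : ℕ} (s : ℕ) (hN : N = M * L ^ s) :
    ((univ : Finset (Fin N)).filter fun a : Fin N => L ^ s ∣ a.val).card = M := by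
  have hps : 0 < L ^ s := pow_pos hL s
  have key : ((univ : Finset (Fin N)).filter fun a : Fin N => L ^ s ∣ a.val).map Fin.valEmbedding =
      (range M).image fun u => u * L ^ s := by
    ext a
    rw [mem_map, mem_image]
    constructor
    · rintro ⟨x, hx, rfl⟩
      obtain ⟨u, hu⟩ := (mem_filter.1 hx).2
      refine ⟨u, mem_range.2 ?_, ?_⟩
      · have : L ^ s * u < L ^ s * M := by
          calc L ^ s * u = x.val := hu.symm
            _ < N := x.isLt
            _ = L ^ s * M := by rw [hN, mul_comm]
        exact Nat.lt_of_mul_lt_mul_left this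
      · simp [Fin.valEmbedding, hu, mul_comm]
    · rintro ⟨u, hu, rfl⟩
      have hlt : u * L ^ s < N := by
        rw [hN]; exact Nat.mul_lt_mul_of_pos_right (mem_range.1 hu) hps
      exact ⟨⟨u * L ^ s, hlt⟩, mem_filter.2 ⟨mem_univ _, Dvd.intro_left _ rfl⟩, rfl⟩
  have hinj : Set.InjOn (fun u => u * L ^ s) (range M : Finset ℕ) := fun u _ u' _ h =>
    Nat.eq_of_mul_eq_mul_right hps h
  rw [← card_map Fin.valEmbedding, key, card_image_of_injOn hinj, card_range]

/-! ## §3 The finite torus: scale cells, nearness, the root-position counts -/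

/-- THE FINE TORUS CELL TYPE `(ℤ∕N)^d` as `Fin d → Fin N` (finite, decidable equality). [folklore] -/
abbrev TCell (d N : ℕ) := Fin d → Fin N

variable {d : ℕ}

/-- A CELL OF SCALE `s`: all coordinates are multiples of `L^s` (a site of the step-`s` lattice). [folklore] -/
def IsScale {N : ℕ} (L s : ℕ) : TCell d N → Prop := fun x => ∀ i, L ^ s ∣ (x i).val

section Cells

open scoped Classical

/-- the cells of scale `s` of the cutoff-`K` torus (`N = n·L^K`) [folklore] -/
noncomputable def cellsAt (n L K s : ℕ) : Finset (TCell d (n * L ^ K)) := univ.filter (IsScale L s)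

/-- **EXACT COUNT OF THE SCALE-`s` CELLS**: `(n·L^{K−s})^d` for `s ≤ K` (`L ≥ 1`). [folklore] -/
theorem card_cellsAt (n : ℕ) {L : ℕ} (hL : 1 ≤ L) {K s : ℕ} (hs : s ≤ K) :
    (cellsAt (d := d) n L K s).card = (n * L ^ (K - s)) ^ d := by
  have hN : n * L ^ K = n * L ^ (K - s) * L ^ s := by
    rw [mul_assoc, ← pow_add, Nat.sub_add_cancel hs]
  have hset : cellsAt (d := d) n L K s =
      Fintype.piFinset fun _ : Fin d => (univ : Finset (Fin (n * L ^ K))).filter fun a : Fin (n * L ^ K) => L ^ s ∣ a.val := by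
    ext x
    simp only [cellsAt, IsScale, mem_filter, mem_univ, true_and, Fintype.mem_piFinset]
  rw [hset, Fintype.card_piFinset, prod_const, card_univ, Fintype.card_fin, card_multiples hL s hN]

/-- … in the chain's currency: `#cellsAt s = n^d · (L^d)^{K−s}` (`V = n^d`, `Λ = L^d`, age `K − s`). [folklore] -/
theorem card_cellsAt_real (n : ℕ) {L : ℕ} (hL : 1 ≤ L) {K s : ℕ} (hs : s ≤ K) :
    ((cellsAt (d := d) n L K s).card : ℝ) = (n : ℝ) ^ d * ((L : ℝ) ^ d) ^ (K - s) := by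
  rw [card_cellsAt n hL hs]; push_cast; ring

end Cells

/-- **NEARNESS ON THE TORUS**: `x` is a cell of scale `sx`, `y` of scale `sy`, `t ≤ K`, and the level-`t` blocks
`⌊x_i∕L^t⌋`, `⌊y_i∕L^t⌋` are within cyclic distance `r` on `ℤ∕(n·L^{K−t})` in every coordinate (sup-metric).
[folklore] -/
def nearT (n L K : ℕ) : TCell d (n * L ^ K) → ℕ → TCell d (n * L ^ K) → ℕ → ℕ → ℝ → Prop :=
  fun x sx y sy t r => t ≤ K ∧ IsScale L sx x ∧ IsScale L sy y ∧
    ∀ i, (cycd (n * L ^ (K - t)) ((x i).val / L ^ t) ((y i).val / L ^ t) : ℝ) ≤ r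

/-- `nearT` is symmetric under exchanging the two cells with their scales [folklore] -/
theorem nearT_comm (n L K : ℕ) (x : TCell d (n * L ^ K)) (sx : ℕ) (y : TCell d (n * L ^ K)) (sy t : ℕ) (r : ℝ) :
    nearT n L K x sx y sy t r ↔ nearT n L K y sy x sx t r := by
  constructor <;>
  · rintro ⟨h1, h2, h3, h4⟩; exact ⟨h1, h3, h2, fun i => by rw [cycd_comm]; exact h4 i⟩

/-- THE ROOT-POSITION COUNT of the torus model: `(2⌊r⌋₊+1)^d · (L^d)^{t∸s}` (blocks at cyclic sup-distance `≤ r` times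
the blocking fibre on the scale-`s` cells; independent of `n`, `K`). [folklore] -/
noncomputable def NZT (d L : ℕ) (r : ℝ) (t s : ℕ) : ℕ := (2 * ⌊r⌋₊ + 1) ^ d * (L ^ d) ^ (t - s)

section Counts

open scoped Classical

/-- THE CORE COUNT (product over coordinates): the cells `z` of scale `s` whose level-`t` blocks are within cyclic
distance `R` of prescribed blocks `c i < m` number at most `((2R+1)·L^{t∸s})^d`. [folklore] -/
theorem card_core_le {L : ℕ} (hL : 1 ≤ L) {N m t : ℕ} (hN : N = m * L ^ t) (c : Fin d → ℕ) (hc : ∀ i, c i < m)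
    (s R : ℕ) :
    ((univ : Finset (TCell d N)).filter fun z =>
        IsScale L s z ∧ ∀ i, cycd m (c i) ((z i).val / L ^ t) ≤ R).card ≤ ((2 * R + 1) * L ^ (t - s)) ^ d := by
  have hset : ((univ : Finset (TCell d N)).filter fun z =>
        IsScale L s z ∧ ∀ i, cycd m (c i) ((z i).val / L ^ t) ≤ R) =
      Fintype.piFinset fun i => (univ : Finset (Fin N)).filter fun a : Fin N =>
        L ^ s ∣ a.val ∧ cycd m (c i) (a.val / L ^ t) ≤ R := by
    ext z
    simp only [IsScale, mem_filter, mem_univ, true_and, Fintype.mem_piFinset]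
    exact ⟨fun h i => ⟨h.1 i, h.2 i⟩, fun h => ⟨fun i => (h i).1, fun i => (h i).2⟩⟩
  rw [hset, Fintype.card_piFinset]
  calc ∏ i, ((univ : Finset (Fin N)).filter fun a : Fin N => L ^ s ∣ a.val ∧ cycd m (c i) (a.val / L ^ t) ≤ R).card
      ≤ ∏ _i : Fin d, (2 * R + 1) * L ^ (t - s) :=
        prod_le_prod (fun i _ => Nat.zero_le _) fun i _ => card_coord_le hL hN (hc i) s R
    _ = ((2 * R + 1) * L ^ (t - s)) ^ d := by rw [prod_const, card_univ, Fintype.card_fin]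

/-- the arithmetic of the count: `((2R+1)·L^{t∸s})^d = NZT` at `R = ⌊r⌋₊` [folklore] -/
theorem core_eq_NZT (d L : ℕ) (r : ℝ) (t s : ℕ) :
    ((2 * ⌊r⌋₊ + 1) * L ^ (t - s)) ^ d = NZT d L r t s := by
  rw [NZT, mul_pow, ← pow_mul, ← pow_mul, mul_comm (t - s) d]

/-- **`hN1` ON THE TORUS**: for a fixed cell `x`, the cells `y` with `nearT x sx y sy t r` number at most
`NZT d L r t sy`. [folklore] -/
theorem card_nearT_le (n : ℕ) {L : ℕ} (hL : 1 ≤ L) (K : ℕ) (x : TCell d (n * L ^ K)) (sx sy t : ℕ) (r : ℝ) :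
    ((univ : Finset (TCell d (n * L ^ K))).filter fun y => nearT n L K x sx y sy t r).card ≤ NZT d L r t sy := by
  by_cases htK : t ≤ K; swap
  · rw [filter_false_of_mem fun y _ h => htK h.1, card_empty]; exact Nat.zero_le _
  have hN : n * L ^ K = n * L ^ (K - t) * L ^ t := by rw [mul_assoc, ← pow_add, Nat.sub_add_cancel htK]
  have hpt : 0 < L ^ t := pow_pos hL t
  have hc : ∀ i, (x i).val / L ^ t < n * L ^ (K - t) := fun i =>
    (Nat.div_lt_iff_lt_mul hpt).2 (by rw [← hN]; exact (x i).isLt)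
  refine le_trans (card_le_card ?_) ((card_core_le hL hN _ hc sy ⌊r⌋₊).trans (core_eq_NZT d L r t sy).le)
  intro y hy
  obtain ⟨-, -, hys, hyd⟩ := (mem_filter.1 hy).2
  exact mem_filter.2 ⟨mem_univ _, hys, fun i => Nat.le_floor (hyd i)⟩

/-- **`hN2` ON THE TORUS**: for a fixed cell `y`, the cells `x` with `nearT x sx y sy t r` number at most
`NZT d L r t sx`. [folklore] -/
theorem card_nearT_le' (n : ℕ) {L : ℕ} (hL : 1 ≤ L) (K : ℕ) (y : TCell d (n * L ^ K)) (sx sy t : ℕ) (r : ℝ) :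
    ((univ : Finset (TCell d (n * L ^ K))).filter fun x => nearT n L K x sx y sy t r).card ≤ NZT d L r t sx := by
  rw [filter_congr fun x _ => nearT_comm n L K x sx y sy t r]
  exact card_nearT_le n hL K y sy sx t r

end Counts

/-- **`hNZ` ON THE TORUS**: `NZT d L r t s ≤ 2^d · (r+1)^d · (L^d)^{t+1−s}` for `r ≥ 0` (`M₀ = 2^d`, `Λ = L^d`; the
spare factor `Λ` is the chain's convention `partnerAges = Σ (t + 1 − s)`). [folklore] -/
theorem NZT_le {L : ℕ} (hL : 1 ≤ L) (d : ℕ) {r : ℝ} (hr : 0 ≤ r) (t s : ℕ) :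
    (NZT d L r t s : ℝ) ≤ (2 : ℝ) ^ d * (r + 1) ^ d * ((L : ℝ) ^ d) ^ (t + 1 - s) := by
  unfold NZT
  push_cast
  have h1 : ((2 : ℝ) * (⌊r⌋₊ : ℕ) + 1) ^ d ≤ (2 : ℝ) ^ d * (r + 1) ^ d := by
    rw [← mul_pow]
    apply pow_le_pow_left₀ (by positivity)
    have := Nat.floor_le hr
    linarith
  have hL1 : (1 : ℝ) ≤ (L : ℝ) ^ d := one_le_pow₀ (by exact_mod_cast hL)
  have h2 : ((L : ℝ) ^ d) ^ (t - s) ≤ ((L : ℝ) ^ d) ^ (t + 1 - s) := pow_le_pow_right₀ hL1 (by omega)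
  exact mul_le_mul h1 h2 (by positivity) (by positivity)

/-! ## §4 The zone-form multiplicity bound ON THE TORUS -/

section Torus

variable {ε : Type*} [DecidableEq ε] [Fintype ε]

open scoped Classical

/-- **THE ZONE-FORM MULTIPLICITY ON THE FINITE TORUS (affine contraction law)**:
`ZoneDrivers.card_admZSet_root_le_crowd_affine` with the cell type `TCell d (n·L^K)`, the nearness `nearT n L K` and
the three root-position binders `hN1`∕`hN2`∕`hNZ` DISCHARGED (`card_nearT_le`, `card_nearT_le'`, `NZT_le`;
`M₀ = 2^d`, `Λ = L^d`).  Displayed: `ext ≥ 0` with `ext t X ≤ C₀·qZ wt σ st X t + c₀`, `wt ≥ 1`, `σ ≥ 0`, well-formed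
`G`. [folklore] -/
theorem card_admZSet_root_le_torus (W : ε → ℕ) (n : ℕ) {L : ℕ} (hL : 1 ≤ L) (K : ℕ)
    (ext : ℕ → Gen ε → ℝ) (hext0 : ∀ t X, 0 ≤ ext t X) (st : ε → ℕ) {C₀ c₀ σ : ℝ} (hC : 0 ≤ C₀) (hc : 0 ≤ c₀)
    (hσ : 0 ≤ σ) (wt : ε → ℝ) (hwt : ∀ w, 1 ≤ wt w) (hext : ∀ t X, ext t X ≤ C₀ * qZ wt σ st X t + c₀)
    {G : Gen ε} (hW : G.WF W) (c c₀' : TCell d (n * L ^ K)) :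
    ((admZSet (nearT n L K) ext st G G.root c c₀').card : ℝ) ≤ ((L : ℝ) ^ d) ^ partnerAges st G *
      (((2 : ℝ) ^ d * (C₀ + 2 * c₀ + 1) ^ d) ^ mergeCount G * mergeProd (fun Z e => qZ wt σ st Z (st e) ^ d) G) :=
  card_admZSet_root_le_crowd_affine W (nearT n L K) ext hext0 st (NZT d L) (by positivity) (by positivity) hC hc hσ d
    (fun x sx sy t r => card_nearT_le n hL K x sx sy t r) (fun y sx sy t r => card_nearT_le' n hL K y sx sy t r)
    (fun r t s hr => NZT_le hL d hr t s) wt hwt hext hW c c₀'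

/-- The same under the per-structure LINEAR law `ext t X ≤ C₀·qZ wt σ st X t` (`c₀ = 0`):
`… ≤ Λ^{partnerAges}·(2^d(C₀+1)^d)^{mergeCount}·mergeProd(q_Z^d)`. [folklore] -/
theorem card_admZSet_root_le_torus_linear (W : ε → ℕ) (n : ℕ) {L : ℕ} (hL : 1 ≤ L) (K : ℕ)
    (ext : ℕ → Gen ε → ℝ) (hext0 : ∀ t X, 0 ≤ ext t X) (st : ε → ℕ) {C₀ σ : ℝ} (hC : 0 ≤ C₀) (hσ : 0 ≤ σ)
    (wt : ε → ℝ) (hwt : ∀ w, 1 ≤ wt w) (hext : ∀ t X, ext t X ≤ C₀ * qZ wt σ st X t)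
    {G : Gen ε} (hW : G.WF W) (c c₀' : TCell d (n * L ^ K)) :
    ((admZSet (nearT n L K) ext st G G.root c c₀').card : ℝ) ≤ ((L : ℝ) ^ d) ^ partnerAges st G *
      (((2 : ℝ) ^ d * (C₀ + 1) ^ d) ^ mergeCount G * mergeProd (fun Z e => qZ wt σ st Z (st e) ^ d) G) :=
  card_admZSet_root_le_crowd W (nearT n L K) ext hext0 st (NZT d L) (by positivity) (by positivity) hC hσ d
    (fun x sx sy t r => card_nearT_le n hL K x sx sy t r) (fun y sx sy t r => card_nearT_le' n hL K y sx sy t r)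
    (fun r t s hr => NZT_le hL d hr t s) wt hwt hext hW c c₀'

end Torus

/-! ## §5 Sanity (decided instances) -/

namespace Sanity

/-- on `ℤ∕7`, around `5`, radius `2`: `{0, 3, 4, 5, 6}` — five residues `= 2·2+1` (the ball wraps) -/
theorem ball_seven : ((range 7).filter fun b => cycd 7 5 b ≤ 2) = {0, 3, 4, 5, 6} := by decide

/-- the count at `d = 4`, `L = 13`, radius `5∕2`, levels `t = 7`, `s = 5`: `NZT = 5^4 · (13^4)^2` -/
theorem NZT_example : NZT 4 13 (5 / 2 : ℝ) 7 5 = 5 ^ 4 * (13 ^ 4) ^ 2 := by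
  have h : ⌊(5 / 2 : ℝ)⌋₊ = 2 := by
    rw [Nat.floor_eq_iff (by norm_num)]; norm_num
  simp [NZT, h]

/-- multiples of `2^1` below `3·2^1 = 6` in `Fin 6`: exactly `3` -/
theorem multiples_six : ((univ : Finset (Fin 6)).filter fun a : Fin 6 => 2 ^ 1 ∣ a.val).card = 3 := by decide

end Sanity

end Summit.QuantumFields.BalabanUV.T4Continuum.ZoneTorus
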